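import Literature.NumberTheory.Sieve.VaughanMeanValueDecomposition
import HarnessLib

/-!
# Route `ChenParityOracleBLAP` — crux S1 = `HostParityFromBrick` (stmt-Parity-20045): Vaughan's identity against a weight

Support file for the prime half `K1 → K2 → HP1` of S1 (step (V)).  For an arbitrary real weight
`h` and height `y`, Vaughan's identity `Λ = Λ_{≤U} + μ_{≤U} * log − c_U * ζ + F_U * G_U`
(tree: `Vaughan.vonMangoldt_eq_four_terms`) and Dirichlet's rearrangement give
(`sum_vonMangoldt_mul_eq_four`)
`∑_{k ≤ y} Λ(k) h(k) = ∑_{k ≤ y} Λ_{≤U}(k)h(k) + ∑_{b ≤ U} μ(b) ∑_{t ≤ y/b} (log t) h(bt)`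
`  − ∑_{b ≤ U²} c_U(b) ∑_{t ≤ y/b} h(bt) + ∑_{U < m ≤ y} G_U(m) ∑_{U < n ≤ y/m} Λ(n) h(mn)`,
with the supports of the truncations made explicit.

References: R. C. Vaughan, Acta Arith. 37 (1980), (12)–(16) [Vaughan1980]; H. Iwaniec,
E. Kowalski, *Analytic Number Theory* (2004), §13.4 [IwaniecKowalski2004].
-/

namespace Summit.Parity.GeneralizedHardyLittlewood.Theorems

open Finset Real
open ArithmeticFunction
open scoped ArithmeticFunction.Moebius ArithmeticFunction.zeta
open Literature.NumberTheory.Sieve.Vaughan (cU gU fU arith_sub_apply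
  sum_Ioc_sum_divisorsAntidiagonal_eq cU_eq_zero_of_lt gU_eq_zero_of_le fU_apply)
open Literature.NumberTheory.Sieve (moebiusTrunc vonMangoldtTrunc moebiusTrunc_apply
  vonMangoldtTrunc_apply)

/-- Dirichlet's rearrangement against a weight (real version):
`∑_{k ≤ y} (f * g)(k) h(k) = ∑_{a ≤ y} f(a) ∑_{b ≤ y/a} g(b) h(ab)`. -/
theorem sum_conv_mul_weight (f g : ArithmeticFunction ℝ) (h : ℕ → ℝ) (y : ℕ) :
    ∑ k ∈ Ioc 0 y, (f * g) k * h k =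
      ∑ a ∈ Ioc 0 y, f a * ∑ b ∈ Ioc 0 (y / a), g b * h (a * b) := by
  have hh := sum_Ioc_sum_divisorsAntidiagonal_eq (fun a b => f a * (g b * h (a * b))) y
  calc ∑ k ∈ Ioc 0 y, (f * g) k * h k
      = ∑ k ∈ Ioc 0 y, ∑ p ∈ k.divisorsAntidiagonal, f p.1 * (g p.2 * h (p.1 * p.2)) := by
        refine Finset.sum_congr rfl fun k _ => ?_
        rw [mul_apply, Finset.sum_mul]
        refine Finset.sum_congr rfl fun p hp => ?_
        rw [Nat.mem_divisorsAntidiagonal] at hp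
        rw [hp.1]; ring
    _ = _ := by rw [hh]; refine Finset.sum_congr rfl fun a _ => ?_; rw [Finset.mul_sum]

/-- Restricting an outer sum to the support `b ≤ B` (`B ≤ y`). -/
theorem sum_Ioc_restrict {B y : ℕ} (hBy : B ≤ y) (F : ℕ → ℝ) (hF : ∀ b, B < b → F b = 0) :
    ∑ b ∈ Ioc 0 y, F b = ∑ b ∈ Ioc 0 B, F b := by
  symm
  refine Finset.sum_subset (Finset.Ioc_subset_Ioc_right hBy) fun b hb hbB => ?_
  rw [Finset.mem_Ioc] at hb
  rw [Finset.mem_Ioc, not_and, not_le] at hbB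
  exact hF b (hbB hb.1)

/-- **Vaughan's identity against a weight.**  For `1 ≤ U`, `U² ≤ y` and any `h : ℕ → ℝ`:
`∑_{k ≤ y} Λ(k)h(k) = ∑_{k ≤ U} Λ(k)h(k) + ∑_{b ≤ U} μ(b) ∑_{t ≤ y/b} log t · h(bt)`
`− ∑_{b ≤ U²} c_U(b) ∑_{t ≤ y/b} h(bt) + ∑_{m ≤ y} G_U(m) ∑_{n ≤ y/m} F_U(n) h(mn)`
[cite: Vaughan1980, (12)–(16)]. -/
theorem sum_vonMangoldt_mul_eq_four {U y : ℕ} (hU : 1 ≤ U) (hUy : U * U ≤ y) (h : ℕ → ℝ) :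
    ∑ k ∈ Ioc 0 y, vonMangoldt k * h k =
      ∑ k ∈ Ioc 0 U, vonMangoldt k * h k +
      ∑ b ∈ Ioc 0 U, (μ b : ℝ) * ∑ t ∈ Ioc 0 (y / b), Real.log t * h (b * t) -
      ∑ b ∈ Ioc 0 (U * U), cU U b * ∑ t ∈ Ioc 0 (y / b), h (b * t) +
      ∑ m ∈ Ioc 0 y, gU U m * ∑ n ∈ Ioc 0 (y / m), fU U n * h (m * n) := by
  have hUy' : U ≤ y := le_trans (Nat.le_mul_of_pos_right U hU) hUy
  have hid := Literature.NumberTheory.Sieve.Vaughan.vonMangoldt_eq_four_terms U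
  -- evaluate the identity at `k` and sum against `h`
  have hpt : ∀ k, vonMangoldt k * h k = vonMangoldtTrunc U k * h k +
      ((moebiusTrunc U : ArithmeticFunction ℝ) * ArithmeticFunction.log) k * h k -
      (cU U * (ζ : ArithmeticFunction ℝ)) k * h k + (gU U * fU U) k * h k := by
    intro k
    have := congrArg (fun F : ArithmeticFunction ℝ => F k) hid
    simp only [ArithmeticFunction.add_apply, arith_sub_apply] at this
    rw [mul_comm (fU U) (gU U)] at this
    rw [this]; ring
  conv_lhs => rw [Finset.sum_congr rfl (fun k _ => hpt k)]
  rw [Finset.sum_add_distrib, Finset.sum_sub_distrib, Finset.sum_add_distrib]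
  congr 1
  · congr 1
    · congr 1
      · -- `Λ_{≤U}`
        rw [sum_Ioc_restrict hUy' _ (fun k hk => by
          rw [vonMangoldtTrunc_apply, if_neg (by omega), zero_mul])]
        refine Finset.sum_congr rfl fun k hk => ?_
        rw [Finset.mem_Ioc] at hk
        rw [vonMangoldtTrunc_apply, if_pos hk.2]
      · -- `μ_{≤U} * log`
        rw [sum_conv_mul_weight, sum_Ioc_restrict hUy' _ (fun b hb => by
          rw [intCoe_apply, moebiusTrunc_apply, if_neg (by omega)]; simp)]
        refine Finset.sum_congr rfl fun b hb => ?_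
        rw [Finset.mem_Ioc] at hb
        rw [intCoe_apply, moebiusTrunc_apply, if_pos hb.2]
        rfl
    · -- `c_U * ζ`
      rw [sum_conv_mul_weight, sum_Ioc_restrict hUy _ (fun b hb => by
        rw [cU_eq_zero_of_lt hb, zero_mul])]
      refine Finset.sum_congr rfl fun b _ => ?_
      congr 1
      refine Finset.sum_congr rfl fun t ht => ?_
      rw [Finset.mem_Ioc] at ht
      rw [natCoe_apply, zeta_apply_ne (by omega)]; simp
  · -- `G_U * F_U`
    rw [sum_conv_mul_weight]

/-- `F_U(n) = Λ(n) [n > U]`, so the inner Type-II sum runs over `U < n ≤ y/m`. -/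
theorem sum_fU_mul_eq (U y m : ℕ) (g : ℕ → ℝ) :
    ∑ n ∈ Ioc 0 (y / m), fU U n * g n = ∑ n ∈ Ioc U (y / m), vonMangoldt n * g n := by
  rcases le_or_gt U (y / m) with hU | hU
  · rw [← Finset.sum_Ioc_consecutive _ (Nat.zero_le U) hU]
    have h0 : ∑ n ∈ Ioc 0 U, fU U n * g n = 0 :=
      Finset.sum_eq_zero fun n hn => by
        rw [Finset.mem_Ioc] at hn; rw [fU_apply, if_pos hn.2, zero_mul]
    rw [h0, zero_add]
    refine Finset.sum_congr rfl fun n hn => ?_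
    rw [Finset.mem_Ioc] at hn; rw [fU_apply, if_neg (by omega)]
  · rw [Finset.Ioc_eq_empty_of_le hU.le, Finset.sum_empty]
    refine Finset.sum_eq_zero fun n hn => ?_
    rw [Finset.mem_Ioc] at hn
    rw [fU_apply, if_pos (hn.2.trans hU.le), zero_mul]

/-- `G_U(m) = 0` for `m ≤ U`, so the outer Type-II sum runs over `U < m ≤ y`. -/
theorem sum_gU_mul_eq {U y : ℕ} (hUy : U ≤ y) (g : ℕ → ℝ) :
    ∑ m ∈ Ioc 0 y, gU U m * g m = ∑ m ∈ Ioc U y, gU U m * g m := by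
  rw [← Finset.sum_Ioc_consecutive _ (Nat.zero_le U) hUy]
  have h0 : ∑ m ∈ Ioc 0 U, gU U m * g m = 0 :=
    Finset.sum_eq_zero fun m hm => by
      rw [Finset.mem_Ioc] at hm; rw [gU_eq_zero_of_le hm.2, zero_mul]
  rw [h0, zero_add]

end Summit.Parity.GeneralizedHardyLittlewood.Theorems
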